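import Summits.BirchSwinnertonDyer.BirchSwinnertonDyer.Theorems.BiquadraticEisensteinDescentManinDatumSupercuspidalCMInertTorsionCoreBezoutFree
import Literature.NumberTheory.EllipticCurves.GaussianLatticeThirdValues
import HarnessLib

/-!
# The `Φ`-twisted `q`-division sums of `E₁*` are rational in `℘(w)`, `℘′(w)` over the `q`-division values — abstract weight
# (crux `ManinDatumSupercuspidalCMInert`, stub `stub_S7`: the algebraic form of the Bézout-free core `Core_q`, part A)

Summit `BirchSwinnertonDyer`, crux `ManinDatumSupercuspidalCMInert` (stmt-BirchSwinnertonDyer-20111, BED r605), registered stub `stub_S7`.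
Width seat bsd-wall-cm-bed-w3 g9 (`--supports 20111`, helper; DICTIONARY LANE). After `…TorsionCoreBezoutFree` (p637721) the research
residual of `stub_S7` is `Core₇`: the `7`-adic order of the sums `T_k(w) = Σ_{b mod 7} \overline{(b/7)₄}^k E₁*(w − b̄/7)` at the torsion points
`w` of `ℂ/(ℤi + ℤ)` of order prime to `7`. This file removes the NON-HOLOMORPHIC Eisenstein–Kronecker function `E₁*` from such sums, for any
modulus `q` and any weight `Φ : ℤ[i] → ℂ` periodic modulo `q`, EVEN (`Φ(−x) = Φ(x)`) and vanishing at `0`: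

* §1 the `q`-division points `v_b = conj(rep_q(b))/q` of the classes `b ∈ (ℤ/q)²`: `v_{−b} ≡ −v_b`, `℘(v_{ib}) = −℘(v_b)` (`℘(iz) = −℘(z)`),
  `M′v_b ∉ Λ` for `b ≠ 0`, `(M′, q) = 1`, hence `℘(w) ≠ ±℘(v_b)` for `w ∉ Λ` with `M′w ∈ Λ`;
* §2 ★ `two_mul_torsionSum_eq`: `2·Σ_b Φ(b)E₁*(w − v_b) = 2E₁*(w)·Σ_b Φ(b) + ℘′(w)·Σ_b Φ(b)/(℘(w) − ℘(v_b))` (pair `b ↔ −b`, then the tree's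
  `GaussianLattice.kroneckerE₁_add_add_sub` «`E₁*(u+v) + E₁*(u−v) − 2E₁*(u) = ℘′(u)/(℘(u) − ℘(v))`» termwise); with `Σ_b Φ(b) = 0` the `E₁*` are
  gone (`torsionSum_eq_half_deriv_mul_sum`); ★ `sum_div_sub_eq_eps_mul_sum_div_add`: `Σ_b Φ(b)/(X − ℘(v_b)) = ε·Σ_b Φ(b)/(X + ℘(v_b))` when
  `Φ(i x) = εΦ(x)` (pair `b ↔ i·b`), whence `= X·Σ_b Φ(b)/(X² − ℘(v_b)²)` (`ε = 1`) or `= Σ_b Φ(b)℘(v_b)/(X² − ℘(v_b)²)` (`ε = −1`).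

Part B (`…TorsionSumRationalSeven`) specialises to `Φ = \overline{(·/q)₄}^k` and `q = 7`. HONEST FRAMING: identities only; nothing here
bounds a valuation or proves `Core₇`, the stub, the crux, Manin's conjecture or BSD. No definition, no named fact, no `sorry`; axioms standard.
-/

set_option autoImplicit false
-- the summit namespace `Summit.BirchSwinnertonDyer.BirchSwinnertonDyer.…` (summit = problem) trips `dupNamespace` on every declaration
set_option linter.dupNamespace false

noncomputable section

open scoped ComplexConjugate
open Complex PeriodPair
open Literature.NumberTheory.EllipticCurves Literature.NumberTheory.EllipticCurves.GaussianLattice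
open Literature.NumberTheory.LFunctions Literature.NumberTheory.LFunctions.GaussianTheta
open Literature.NumberTheory.QuadraticFields.GaussianQuarticSymbol

namespace Summit.BirchSwinnertonDyer.BirchSwinnertonDyer.Theorems.BiquadraticEisensteinDescentManinDatumSupercuspidalCMInertTorsionSumRational

open Summit.BirchSwinnertonDyer.BirchSwinnertonDyer.Theorems.BiquadraticEisensteinDescentManinDatumSupercuspidalCMInertTorsionCoreBezoutFree
  (phiq_intCast_mul phiq_periodic isCoprime_of_not_dvd)

/-! ## §1 The `q`-division points `v_b = b̄/q` of the classes `b` modulo `q` -/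

section DivPoints

variable (q : ℕ) [NeZero q]

/-- The representative of `−b` is `−rep(b)` up to `qℤ[i]`. [folklore] -/
theorem exists_rep_neg (b : ZMod q × ZMod q) : ∃ y : GaussianInt, rep q (-b) 0 = -rep q b 0 + q * y := by
  have hcls : cls q (-rep q b 0) = -b := by
    ext <;> simp [cls, rep]
  obtain ⟨y, hy⟩ := exists_rep_eq q hcls
  refine ⟨-⟨y.1, y.2⟩, ?_⟩
  have h := rep_eq_rep_zero_add q (-b) y
  rw [hy] at h
  linear_combination (-1 : GaussianInt) * h

/-- The representative of `i·b = (−b₂, b₁)` is `i·rep(b)` up to `qℤ[i]`. [folklore] -/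
theorem exists_rep_mulI (b : ZMod q × ZMod q) :
    ∃ y : GaussianInt, rep q (-b.2, b.1) 0 = ⟨0, 1⟩ * rep q b 0 + q * y := by
  have hcls : cls q (⟨0, 1⟩ * rep q b 0) = (-b.2, b.1) := by
    ext <;> simp [cls, rep]
  obtain ⟨y, hy⟩ := exists_rep_eq q hcls
  refine ⟨-⟨y.1, y.2⟩, ?_⟩
  have h := rep_eq_rep_zero_add q (-b.2, b.1) y
  rw [hy] at h
  linear_combination (-1 : GaussianInt) * h

/-- `E₁*(w − conj(rep(−b))/q) = E₁*(w + conj(rep b)/q)` (`E₁*` is `Λ`-periodic). [folklore] -/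
theorem kroneckerE₁_sub_divPoint_neg (w : ℂ) (b : ZMod q × ZMod q) :
    kroneckerE₁ (w - conj ((rep q (-b) 0 : GaussianInt) : ℂ) / q) = kroneckerE₁ (w + conj ((rep q b 0 : GaussianInt) : ℂ) / q) := by
  have hq0 : (q : ℂ) ≠ 0 := Nat.cast_ne_zero.mpr (NeZero.ne q)
  obtain ⟨y, hy⟩ := exists_rep_neg q b
  have harg : w - conj ((rep q (-b) 0 : GaussianInt) : ℂ) / q =
      (w + conj ((rep q b 0 : GaussianInt) : ℂ) / q) + (-1 : ℤ) • conj ((y : GaussianInt) : ℂ) := by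
    rw [hy, GaussianInt.toComplex_add, GaussianInt.toComplex_mul, GaussianInt.toComplex_neg, map_natCast,
      map_add, map_neg, map_mul, map_natCast, zsmul_eq_mul]
    field_simp
    ring
  rw [harg, kroneckerE₁_add_of_mem _ ((ofUpperHalfPlane UpperHalfPlane.I).lattice.smul_mem _ (conj_toComplex_mem_lattice y))]

/-- `℘(conj(rep(i·b))/q) = −℘(conj(rep b)/q)` (`conj(i x) = −i·conj x`, `℘(−iz) = ℘(iz) = −℘(z)`, periodicity). [folklore] -/
theorem weierstrassP_divPoint_mulI (b : ZMod q × ZMod q) :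
    ℘[ofUpperHalfPlane UpperHalfPlane.I] (conj ((rep q (-b.2, b.1) 0 : GaussianInt) : ℂ) / q) =
      -℘[ofUpperHalfPlane UpperHalfPlane.I] (conj ((rep q b 0 : GaussianInt) : ℂ) / q) := by
  have hq0 : (q : ℂ) ≠ 0 := Nat.cast_ne_zero.mpr (NeZero.ne q)
  obtain ⟨y, hy⟩ := exists_rep_mulI q b
  have hI : (((⟨0, 1⟩ : GaussianInt)) : ℂ) = I := by
    rw [GaussianInt.toComplex_def]; simp
  have harg : conj ((rep q (-b.2, b.1) 0 : GaussianInt) : ℂ) / q =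
      I * (-(conj ((rep q b 0 : GaussianInt) : ℂ) / q)) +
        ((⟨_, conj_toComplex_mem_lattice y⟩ : (ofUpperHalfPlane UpperHalfPlane.I).lattice) : ℂ) := by
    rw [Subtype.coe_mk, hy, GaussianInt.toComplex_add, GaussianInt.toComplex_mul, GaussianInt.toComplex_mul, hI, map_natCast,
      map_add, map_mul, map_mul, Complex.conj_I, map_natCast]
    field_simp
  rw [harg, (ofUpperHalfPlane UpperHalfPlane.I).weierstrassP_add_coe, GaussianLattice.weierstrassP_I_mul,
    (ofUpperHalfPlane UpperHalfPlane.I).weierstrassP_neg]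

/-- `M′·b̄/q ∉ Λ` for `b ≠ 0` and `M′` prime to `q` (compare `M′·rep(b) = q·(n − m i)` componentwise: `q ∣ M′ bᵢ`, `0 ≤ bᵢ < q`).
[folklore] -/
theorem natCast_mul_divPoint_not_mem {M' : ℕ} (hM : M'.Coprime q) {b : ZMod q × ZMod q} (hb : b ≠ 0) :
    (M' : ℂ) * (conj ((rep q b 0 : GaussianInt) : ℂ) / q) ∉ (ofUpperHalfPlane UpperHalfPlane.I).lattice := by
  intro h
  have hq0 : (q : ℂ) ≠ 0 := Nat.cast_ne_zero.mpr (NeZero.ne q)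
  obtain ⟨m, n, hmn⟩ := mem_lattice_iff.mp h
  -- `M′ · rep(b) = q · (n − m i)` in `ℤ[i]`
  have h1 : ((((M' : ℤ) : GaussianInt) * rep q b 0 : GaussianInt) : ℂ) = ((((q : ℤ) : GaussianInt) * ⟨n, -m⟩ : GaussianInt) : ℂ) := by
    have h2 : (M' : ℂ) * conj ((rep q b 0 : GaussianInt) : ℂ) = q * ((m : ℂ) * I + n) := by
      rw [hmn]; field_simp
    have h3 := congrArg conj h2
    simp only [map_mul, map_natCast, Complex.conj_conj, map_add, map_intCast, Complex.conj_I] at h3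
    rw [GaussianInt.toComplex_mul, GaussianInt.toComplex_mul, map_intCast, map_intCast,
      GaussianInt.toComplex_def₂ (⟨n, -m⟩ : GaussianInt)]
    push_cast at h3 ⊢
    rw [h3]
    apply Complex.ext <;> simp
  have h4 : ((M' : ℤ) : GaussianInt) * rep q b 0 = ((q : ℤ) : GaussianInt) * ⟨n, -m⟩ := GaussianInt.toComplex_inj.mp h1
  have hre : (M' : ℤ) * (b.1.val : ℤ) = q * n := by
    have := congrArg Zsqrtd.re h4
    simpa [rep, -ZMod.natCast_val] using this
  have him : (M' : ℤ) * (b.2.val : ℤ) = -(q * m) := by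
    have := congrArg Zsqrtd.im h4
    simp [rep, -ZMod.natCast_val] at this
    linarith
  -- `q ∣ M′·bᵢ`, `gcd(M′, q) = 1` ⇒ `q ∣ bᵢ` ⇒ `bᵢ = 0` in `ℤ/q`
  have hcop : IsCoprime (q : ℤ) (M' : ℤ) := Nat.isCoprime_iff_coprime.mpr hM.symm
  have hd1 : (q : ℤ) ∣ (b.1.val : ℤ) := hcop.dvd_of_dvd_mul_left ⟨n, by linear_combination hre⟩
  have hd2 : (q : ℤ) ∣ (b.2.val : ℤ) := hcop.dvd_of_dvd_mul_left ⟨-m, by linear_combination him⟩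
  have h1' : b.1 = 0 := by
    rw [← ZMod.natCast_zmod_val b.1, ZMod.natCast_eq_zero_iff]
    exact_mod_cast hd1
  have h2' : b.2 = 0 := by
    rw [← ZMod.natCast_zmod_val b.2, ZMod.natCast_eq_zero_iff]
    exact_mod_cast hd2
  exact hb (Prod.ext h1' h2')

/-- `b̄/q ∉ Λ` for `b ≠ 0`. [folklore] -/
theorem divPoint_not_mem {b : ZMod q × ZMod q} (hb : b ≠ 0) :
    conj ((rep q b 0 : GaussianInt) : ℂ) / q ∉ (ofUpperHalfPlane UpperHalfPlane.I).lattice := by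
  have h := natCast_mul_divPoint_not_mem q (M' := 1) (Nat.coprime_one_left q) hb
  rwa [Nat.cast_one, one_mul] at h

/-- For `w ∉ Λ` with `M′w ∈ Λ`, `M′` prime to `q`, and `b ≠ 0`: `℘(w) ≠ ±℘(b̄/q)` (`w ± b̄/q`, `w ± i b̄/q ∉ Λ`). [folklore] -/
theorem weierstrassP_ne_of_torsion {M' : ℕ} (hM : M'.Coprime q) {w : ℂ} (hw : w ∉ (ofUpperHalfPlane UpperHalfPlane.I).lattice)
    (hMw : (M' : ℂ) * w ∈ (ofUpperHalfPlane UpperHalfPlane.I).lattice) {b : ZMod q × ZMod q} (hb : b ≠ 0) :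
    ℘[ofUpperHalfPlane UpperHalfPlane.I] w ≠ ℘[ofUpperHalfPlane UpperHalfPlane.I] (conj ((rep q b 0 : GaussianInt) : ℂ) / q) ∧
      ℘[ofUpperHalfPlane UpperHalfPlane.I] w ≠ -℘[ofUpperHalfPlane UpperHalfPlane.I] (conj ((rep q b 0 : GaussianInt) : ℂ) / q) := by
  set Λ := (ofUpperHalfPlane UpperHalfPlane.I).lattice with hΛ
  set v : ℂ := conj ((rep q b 0 : GaussianInt) : ℂ) / q with hv
  -- `w ± u ∉ Λ` whenever `M′u ∉ Λ`
  have key : ∀ u : ℂ, (M' : ℂ) * u ∉ Λ → w + u ∉ Λ ∧ w - u ∉ Λ := by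
    intro u hu
    constructor
    · intro h
      apply hu
      have := Λ.sub_mem (Λ.smul_mem (M' : ℤ) h) hMw
      simpa [zsmul_eq_mul, mul_add] using this
    · intro h
      apply hu
      have := Λ.sub_mem hMw (Λ.smul_mem (M' : ℤ) h)
      simpa [zsmul_eq_mul, mul_sub] using this
  have hvΛ : v ∉ Λ := divPoint_not_mem q hb
  have hMv : (M' : ℂ) * v ∉ Λ := natCast_mul_divPoint_not_mem q hM hb
  obtain ⟨h1, h2⟩ := key v hMv
  have hIv : ℘[ofUpperHalfPlane UpperHalfPlane.I] (I * v) = -℘[ofUpperHalfPlane UpperHalfPlane.I] v :=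
    GaussianLattice.weierstrassP_I_mul v
  have hIvΛ : I * v ∉ Λ := fun h ↦ hvΛ ((I_mul_mem_lattice_ofUpperHalfPlane_I_iff v).mp h)
  have hMIv : (M' : ℂ) * (I * v) ∉ Λ := fun h ↦ hMv
    ((I_mul_mem_lattice_ofUpperHalfPlane_I_iff ((M' : ℂ) * v)).mp (by simpa [mul_left_comm] using h))
  obtain ⟨h3, h4⟩ := key (I * v) hMIv
  refine ⟨fun h ↦ ?_, fun h ↦ ?_⟩
  · rcases ((ofUpperHalfPlane UpperHalfPlane.I).weierstrassP_eq_weierstrassP_iff hw hvΛ).mp h with h' | h'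
    · exact h1 h'
    · exact h2 h'
  · rw [← hIv] at h
    rcases ((ofUpperHalfPlane UpperHalfPlane.I).weierstrassP_eq_weierstrassP_iff hw hIvΛ).mp h with h' | h'
    · exact h3 h'
    · exact h4 h'

end DivPoints

/-! ## §2 The identities for an abstract `q`-periodic weight `Φ` -/

section Abstract

variable (q : ℕ) [NeZero q] {Φ : GaussianInt → ℂ} (hΦper : ∀ x y : GaussianInt, Φ (x + q * y) = Φ x)
include hΦper

/-- `Φ(rep(−b)) = Φ(rep b)` for an even, `q`-periodic weight. [folklore] -/
theorem phi_rep_neg (hΦneg : ∀ x : GaussianInt, Φ (-x) = Φ x) (b : ZMod q × ZMod q) :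
    Φ (rep q (-b) 0) = Φ (rep q b 0) := by
  obtain ⟨y, hy⟩ := exists_rep_neg q b
  rw [hy, hΦper, hΦneg]

/-- `Φ(rep(i·b)) = ε·Φ(rep b)` for a `q`-periodic weight with `Φ(i x) = ε Φ(x)`. [folklore] -/
theorem phi_rep_mulI {ε : ℂ} (hΦI : ∀ x : GaussianInt, Φ (⟨0, 1⟩ * x) = ε * Φ x) (b : ZMod q × ZMod q) :
    Φ (rep q (-b.2, b.1) 0) = ε * Φ (rep q b 0) := by
  obtain ⟨y, hy⟩ := exists_rep_mulI q b
  rw [hy, hΦper, hΦI]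

omit [NeZero q] hΦper in
/-- `rep q 0 0 = 0`. [folklore] -/
theorem rep_zero_zero : rep q (0 : ZMod q × ZMod q) 0 = 0 := by
  ext <;> simp [rep]

/-- **(i) `Σ_b Φ(b) E₁*(w − b̄/q) = Σ_b Φ(b) E₁*(w + b̄/q)`** for an even `q`-periodic weight (re-index `b ↦ −b`). [folklore] -/
theorem torsionSum_eq_sum_add (hΦneg : ∀ x : GaussianInt, Φ (-x) = Φ x) (w : ℂ) :
    ∑ b : ZMod q × ZMod q, Φ (rep q b 0) * kroneckerE₁ (w - conj ((rep q b 0 : GaussianInt) : ℂ) / q) =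
      ∑ b : ZMod q × ZMod q, Φ (rep q b 0) * kroneckerE₁ (w + conj ((rep q b 0 : GaussianInt) : ℂ) / q) := by
  rw [← Equiv.sum_comp (Equiv.neg (ZMod q × ZMod q))
    (fun b ↦ Φ (rep q b 0) * kroneckerE₁ (w - conj ((rep q b 0 : GaussianInt) : ℂ) / q))]
  refine Finset.sum_congr rfl fun b _ ↦ ?_
  simp only [Equiv.neg_apply]
  rw [phi_rep_neg q hΦper hΦneg, kroneckerE₁_sub_divPoint_neg]

/-- **(ii) `2·Σ_b Φ(b)E₁*(w − b̄/q) = 2E₁*(w)·Σ_b Φ(b) + ℘′(w)·Σ_b Φ(b)/(℘(w) − ℘(b̄/q))`** for an even `q`-periodic weight with `Φ(0) = 0`,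
at every `w ∉ Λ` with `M′w ∈ Λ`, `M′` prime to `q` (pair `b ↔ −b` and apply `E₁*(u+v) + E₁*(u−v) − 2E₁*(u) = ℘′(u)/(℘(u) − ℘(v))`,
the tree's `GaussianLattice.kroneckerE₁_add_add_sub`, termwise). [folklore] -/
theorem two_mul_torsionSum_eq (hΦneg : ∀ x : GaussianInt, Φ (-x) = Φ x) (hΦ0 : Φ 0 = 0) {M' : ℕ} (hM : M'.Coprime q)
    {w : ℂ} (hw : w ∉ (ofUpperHalfPlane UpperHalfPlane.I).lattice)
    (hMw : (M' : ℂ) * w ∈ (ofUpperHalfPlane UpperHalfPlane.I).lattice) :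
    2 * ∑ b : ZMod q × ZMod q, Φ (rep q b 0) * kroneckerE₁ (w - conj ((rep q b 0 : GaussianInt) : ℂ) / q) =
      2 * kroneckerE₁ w * ∑ b : ZMod q × ZMod q, Φ (rep q b 0) +
        ℘'[ofUpperHalfPlane UpperHalfPlane.I] w * ∑ b : ZMod q × ZMod q, Φ (rep q b 0) /
          (℘[ofUpperHalfPlane UpperHalfPlane.I] w - ℘[ofUpperHalfPlane UpperHalfPlane.I] (conj ((rep q b 0 : GaussianInt) : ℂ) / q)) := by
  have h2 : 2 * ∑ b : ZMod q × ZMod q, Φ (rep q b 0) * kroneckerE₁ (w - conj ((rep q b 0 : GaussianInt) : ℂ) / q) =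
      ∑ b : ZMod q × ZMod q, Φ (rep q b 0) * (kroneckerE₁ (w + conj ((rep q b 0 : GaussianInt) : ℂ) / q) +
        kroneckerE₁ (w - conj ((rep q b 0 : GaussianInt) : ℂ) / q)) := by
    rw [two_mul]
    nth_rewrite 1 [torsionSum_eq_sum_add q hΦper hΦneg w]
    rw [← Finset.sum_add_distrib]
    refine Finset.sum_congr rfl fun b _ ↦ by ring
  rw [h2, Finset.mul_sum, Finset.mul_sum, ← Finset.sum_add_distrib]
  refine Finset.sum_congr rfl fun b _ ↦ ?_
  by_cases hb : b = 0
  · subst hb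
    rw [rep_zero_zero, hΦ0]
    simp
  · obtain ⟨hne, -⟩ := weierstrassP_ne_of_torsion q hM hw hMw hb
    have key := kroneckerE₁_add_add_sub hw (divPoint_not_mem q hb) hne
    linear_combination Φ (rep q b 0) * key

/-- **(ii′) With the character sum `Σ_b Φ(b) = 0`: `Σ_b Φ(b)E₁*(w − b̄/q) = ½·℘′(w)·Σ_b Φ(b)/(℘(w) − ℘(b̄/q))`** — the `E₁*` are gone.
[folklore] -/
theorem torsionSum_eq_half_deriv_mul_sum (hΦneg : ∀ x : GaussianInt, Φ (-x) = Φ x) (hΦ0 : Φ 0 = 0)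
    (hΦsum : ∑ b : ZMod q × ZMod q, Φ (rep q b 0) = 0) {M' : ℕ} (hM : M'.Coprime q)
    {w : ℂ} (hw : w ∉ (ofUpperHalfPlane UpperHalfPlane.I).lattice)
    (hMw : (M' : ℂ) * w ∈ (ofUpperHalfPlane UpperHalfPlane.I).lattice) :
    ∑ b : ZMod q × ZMod q, Φ (rep q b 0) * kroneckerE₁ (w - conj ((rep q b 0 : GaussianInt) : ℂ) / q) =
      (1 / 2 : ℂ) * ℘'[ofUpperHalfPlane UpperHalfPlane.I] w * ∑ b : ZMod q × ZMod q, Φ (rep q b 0) /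
          (℘[ofUpperHalfPlane UpperHalfPlane.I] w - ℘[ofUpperHalfPlane UpperHalfPlane.I] (conj ((rep q b 0 : GaussianInt) : ℂ) / q)) := by
  have h := two_mul_torsionSum_eq q hΦper hΦneg hΦ0 hM hw hMw
  rw [hΦsum, mul_zero, zero_add] at h
  linear_combination (1 / 2 : ℂ) * h

/-- **(iii) `Σ_b Φ(b)/(X − ℘(b̄/q)) = ε · Σ_b Φ(b)/(X + ℘(b̄/q))`** for a `q`-periodic weight with `Φ(i x) = ε Φ(x)` (re-index `b ↦ i·b`,
`℘(i v) = −℘(v)`). [folklore] -/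
theorem sum_div_sub_eq_eps_mul_sum_div_add {ε : ℂ} (hΦI : ∀ x : GaussianInt, Φ (⟨0, 1⟩ * x) = ε * Φ x) (X : ℂ) :
    ∑ b : ZMod q × ZMod q, Φ (rep q b 0) / (X - ℘[ofUpperHalfPlane UpperHalfPlane.I] (conj ((rep q b 0 : GaussianInt) : ℂ) / q)) =
      ε * ∑ b : ZMod q × ZMod q, Φ (rep q b 0) / (X + ℘[ofUpperHalfPlane UpperHalfPlane.I] (conj ((rep q b 0 : GaussianInt) : ℂ) / q)) := by
  -- `τ b = (−b₂, b₁)` is a bijection of `(ℤ/q)²`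
  set τ : ZMod q × ZMod q → ZMod q × ZMod q := fun b ↦ (-b.2, b.1) with hτ
  have hτinj : Function.Injective τ := by
    intro b b' h
    simp only [hτ, Prod.mk.injEq, neg_inj] at h
    exact Prod.ext h.2 h.1
  have hτbij : Function.Bijective τ := Finite.injective_iff_bijective.mp hτinj
  rw [Finset.mul_sum]
  symm
  refine Fintype.sum_bijective τ hτbij _ _ fun b ↦ ?_
  simp only [hτ]
  rw [phi_rep_mulI q hΦper hΦI, weierstrassP_divPoint_mulI, sub_neg_eq_add, mul_div_assoc]

/-- **(iv) `ε = 1`: `Σ_b Φ(b)/(X − ℘(b̄/q)) = X · Σ_b Φ(b)/(X² − ℘(b̄/q)²)`**, provided `X ≠ ±℘(b̄/q)` for `b ≠ 0` and `Φ(0) = 0`. [folklore] -/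
theorem sum_div_sub_eq_mul_sum_div_sq_sub (hΦI : ∀ x : GaussianInt, Φ (⟨0, 1⟩ * x) = Φ x) (hΦ0 : Φ 0 = 0) {X : ℂ}
    (hX : ∀ b : ZMod q × ZMod q, b ≠ 0 →
      X ≠ ℘[ofUpperHalfPlane UpperHalfPlane.I] (conj ((rep q b 0 : GaussianInt) : ℂ) / q) ∧
      X ≠ -℘[ofUpperHalfPlane UpperHalfPlane.I] (conj ((rep q b 0 : GaussianInt) : ℂ) / q)) :
    ∑ b : ZMod q × ZMod q, Φ (rep q b 0) / (X - ℘[ofUpperHalfPlane UpperHalfPlane.I] (conj ((rep q b 0 : GaussianInt) : ℂ) / q)) =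
      X * ∑ b : ZMod q × ZMod q, Φ (rep q b 0) /
        (X ^ 2 - ℘[ofUpperHalfPlane UpperHalfPlane.I] (conj ((rep q b 0 : GaussianInt) : ℂ) / q) ^ 2) := by
  have h := sum_div_sub_eq_eps_mul_sum_div_add q hΦper (ε := 1) (fun x ↦ by rw [hΦI, one_mul]) X
  rw [one_mul] at h
  -- `2·LHS = LHS + RHS' = Σ Φ·2X/(X² − x²)`
  have h2 : 2 * ∑ b : ZMod q × ZMod q, Φ (rep q b 0) /
      (X - ℘[ofUpperHalfPlane UpperHalfPlane.I] (conj ((rep q b 0 : GaussianInt) : ℂ) / q)) =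
      2 * (X * ∑ b : ZMod q × ZMod q, Φ (rep q b 0) /
        (X ^ 2 - ℘[ofUpperHalfPlane UpperHalfPlane.I] (conj ((rep q b 0 : GaussianInt) : ℂ) / q) ^ 2)) := by
    rw [two_mul]
    nth_rewrite 2 [h]
    rw [← Finset.sum_add_distrib, Finset.mul_sum, Finset.mul_sum]
    refine Finset.sum_congr rfl fun b _ ↦ ?_
    by_cases hb : b = 0
    · subst hb
      rw [rep_zero_zero, hΦ0]
      simp
    · obtain ⟨h1, h2⟩ := hX b hb
      set y : ℂ := ℘[ofUpperHalfPlane UpperHalfPlane.I] (conj ((rep q b 0 : GaussianInt) : ℂ) / q) with hy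
      have h1' : X - y ≠ 0 := sub_ne_zero.mpr h1
      have h2' : X + y ≠ 0 := by rw [Ne, add_eq_zero_iff_eq_neg]; exact h2
      have h3' : X ^ 2 - y ^ 2 ≠ 0 := by rw [sq_sub_sq]; exact mul_ne_zero h2' h1'
      field_simp
      ring
  exact mul_left_cancel₀ two_ne_zero h2

/-- **(iv′) `ε = −1`: `Σ_b Φ(b)/(X − ℘(b̄/q)) = Σ_b Φ(b)℘(b̄/q)/(X² − ℘(b̄/q)²)`**, provided `X ≠ ±℘(b̄/q)` for `b ≠ 0` and `Φ(0) = 0`.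
[folklore] -/
theorem sum_div_sub_eq_sum_mul_div_sq_sub (hΦI : ∀ x : GaussianInt, Φ (⟨0, 1⟩ * x) = -Φ x) (hΦ0 : Φ 0 = 0) {X : ℂ}
    (hX : ∀ b : ZMod q × ZMod q, b ≠ 0 →
      X ≠ ℘[ofUpperHalfPlane UpperHalfPlane.I] (conj ((rep q b 0 : GaussianInt) : ℂ) / q) ∧
      X ≠ -℘[ofUpperHalfPlane UpperHalfPlane.I] (conj ((rep q b 0 : GaussianInt) : ℂ) / q)) :
    ∑ b : ZMod q × ZMod q, Φ (rep q b 0) / (X - ℘[ofUpperHalfPlane UpperHalfPlane.I] (conj ((rep q b 0 : GaussianInt) : ℂ) / q)) =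
      ∑ b : ZMod q × ZMod q, Φ (rep q b 0) * ℘[ofUpperHalfPlane UpperHalfPlane.I] (conj ((rep q b 0 : GaussianInt) : ℂ) / q) /
        (X ^ 2 - ℘[ofUpperHalfPlane UpperHalfPlane.I] (conj ((rep q b 0 : GaussianInt) : ℂ) / q) ^ 2) := by
  have h := sum_div_sub_eq_eps_mul_sum_div_add q hΦper (ε := -1) (fun x ↦ by rw [hΦI, neg_one_mul]) X
  have h2 : 2 * ∑ b : ZMod q × ZMod q, Φ (rep q b 0) /
      (X - ℘[ofUpperHalfPlane UpperHalfPlane.I] (conj ((rep q b 0 : GaussianInt) : ℂ) / q)) =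
      2 * ∑ b : ZMod q × ZMod q, Φ (rep q b 0) * ℘[ofUpperHalfPlane UpperHalfPlane.I] (conj ((rep q b 0 : GaussianInt) : ℂ) / q) /
        (X ^ 2 - ℘[ofUpperHalfPlane UpperHalfPlane.I] (conj ((rep q b 0 : GaussianInt) : ℂ) / q) ^ 2) := by
    rw [two_mul]
    nth_rewrite 2 [h]
    rw [neg_one_mul, ← sub_eq_add_neg, ← Finset.sum_sub_distrib, Finset.mul_sum]
    refine Finset.sum_congr rfl fun b _ ↦ ?_
    by_cases hb : b = 0
    · subst hb
      rw [rep_zero_zero, hΦ0]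
      simp
    · obtain ⟨h1, h2⟩ := hX b hb
      set y : ℂ := ℘[ofUpperHalfPlane UpperHalfPlane.I] (conj ((rep q b 0 : GaussianInt) : ℂ) / q) with hy
      have h1' : X - y ≠ 0 := sub_ne_zero.mpr h1
      have h2' : X + y ≠ 0 := by rw [Ne, add_eq_zero_iff_eq_neg]; exact h2
      have h3' : X ^ 2 - y ^ 2 ≠ 0 := by rw [sq_sub_sq]; exact mul_ne_zero h2' h1'
      field_simp
      ring
  exact mul_left_cancel₀ two_ne_zero h2

end Abstract

end Summit.BirchSwinnertonDyer.BirchSwinnertonDyer.Theorems.BiquadraticEisensteinDescentManinDatumSupercuspidalCMInertTorsionSumRational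

end
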